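import Summits.RiemannHypothesis.RiemannHypothesis.Theorems.Splittings.SplitXWucK1RL
import HarnessLib

/-!
# Splittings — x-wuc GEN-11 `SplitXWucK1R` (K1′(ℝ) AT THE STAKE) — mechanical carve part 13/14
Continuation of `Summits.RiemannHypothesis.RiemannHypothesis.Theorems.Splittings.SplitXWucK1RL`: byte-identical declaration units of the referee-passed extract `SplitXWucK1R.lean`
sha16 70c8eb2af2868881 (x-wuc g11; ref g10 PASS 2026-08-27T22:59:46Z; RULING #330); open namespaces/sections re-opened with their context.
HONEST LABEL: splitting search over kernel-typed RH-equivalences; K-CERT′ (complex `f`) stays OPEN; nothing here bears on the truth of RH.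
-/
set_option linter.dupNamespace false
noncomputable section
open scoped Classical ComplexConjugate
open Set Filter Topology Complex MeasureTheory
open Real Set Filter Topology
open Real Set MeasureTheory Complex Filter Topology
open scoped Real
namespace Summit.RiemannHypothesis.RiemannHypothesis.Theorems.Splittings.XWucG8.DSLine
open scoped ComplexConjugate
set_option maxHeartbeats 2400000 in
/-- **THE LOCALISED TWO-LOBE CERTIFICATE** (blueprint §L; real `f`, `2π(21/500)D ≥ 1`, `θ ≤ 21/500`). -/
theorem certBodyR_of_local {ε κ₀ D θ : ℝ} (hε : 0 < ε) (hκ₀ : 0 < κ₀) (hκ₀' : κ₀ < 1 / 2) (hD : 1 ≤ D)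
    (hθ : θ ≤ 21 / 500) (hDlarge : 1 ≤ 2 * Real.pi * (21 / 500) * D)
    {f : ℝ → ℂ} (hfc : Continuous f) (hreal : ∀ u : ℝ, (f u).im = 0) :
    CertBodyR ε κ₀ D 400 (3 / 2) θ f := by
  have hπlo := Real.pi_gt_d6
  have hπhi := Real.pi_lt_d6
  have hπne : (π : ℝ) ≠ 0 := Real.pi_pos.ne'
  have hgc : Continuous (oddPart f) := continuous_oddPart hfc
  have hEf0 : 0 ≤ ∫ u in Icc (-1 : ℝ) 1, ‖f u‖ ^ 2 := integral_nonneg fun u => by positivity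
  have hEg0 : 0 ≤ ∫ u in Icc (-1 : ℝ) 1, ‖oddPart f u‖ ^ 2 := integral_nonneg fun u => by positivity
  have hEgf : (∫ u in Icc (-1 : ℝ) 1, ‖oddPart f u‖ ^ 2) ≤ ∫ u in Icc (-1 : ℝ) 1, ‖f u‖ ^ 2 := by
    have h := integral_norm_sq_oddPart_le hfc
    have e : SignConeRung.oddPart f = oddPart f := rfl
    rw [e] at h
    exact h
  -- the global bound `M = √(2 E_g)`
  set M : ℝ := Real.sqrt (2 * ∫ u in Icc (-1 : ℝ) 1, ‖oddPart f u‖ ^ 2) with hM_def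
  have hM0 : 0 ≤ M := Real.sqrt_nonneg _
  have hmax : ∀ y : ℝ, ‖tfT (oddPart f) y 0‖ ≤ M := fun y => norm_tfT_le_sqrt_energy (oddPart f) hgc y
  have hM2 : M ^ 2 = 2 * ∫ u in Icc (-1 : ℝ) 1, ‖oddPart f u‖ ^ 2 := Real.sq_sqrt (by linarith)
  -- `√D`, the radius `R`, the tail `τ`
  set sD : ℝ := Real.sqrt D with hsD
  have hsD2 : sD ^ 2 = D := Real.sq_sqrt (by linarith)
  have hsD1 : 1 ≤ sD := by
    rw [hsD, ← Real.sqrt_one]; exact Real.sqrt_le_sqrt (by linarith)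
  have hsD0 : 0 < sD := by linarith
  have hsDne : sD ≠ 0 := hsD0.ne'
  have hsDD : sD ≤ D := by
    have h := mul_le_mul_of_nonneg_left hsD1 hsD0.le
    nlinarith [h, hsD2]
  have hD0 : 0 < D := by linarith
  set R : ℝ := 60000 * sD with hR
  have hR0 : 0 < R := by positivity
  have hRne : R ≠ 0 := hR0.ne'
  have hRπ : π ≤ R := by rw [hR]; linarith
  set τ : ℝ := 2 / (π * R) + 2 / R ^ 2 with hτ
  have hτ0 : 0 ≤ τ := by positivity
  have hτb : τ * sD ≤ 10616 / 10 ^ 9 := by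
    have e1 : 2 / (π * R) * sD = 2 / (π * 60000) := by rw [hR]; field_simp
    have e2 : 2 / R ^ 2 * sD = 2 / (60000 ^ 2 * sD) := by rw [hR]; field_simp
    rw [hτ, add_mul, e1, e2]
    have h1 : 2 / (π * 60000) ≤ 2 / (3.141592 * 60000) :=
      div_le_div_of_nonneg_left (by norm_num) (by positivity) (by linarith)
    have h2 : 2 / (60000 ^ 2 * sD) ≤ 2 / (60000 ^ 2 * 1) :=
      div_le_div_of_nonneg_left (by norm_num) (by positivity) (by linarith)
    have h3 : (2 : ℝ) / (3.141592 * 60000) + 2 / (60000 ^ 2 * 1) ≤ 10616 / 10 ^ 9 := by norm_num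
    linarith
  -- the step count `J`, the radii `ρ k = 2R + k(R+4)`, the band
  set J : ℕ := ⌈18700 * sD⌉₊ with hJ
  have hJge : 18700 * sD ≤ (J : ℝ) := Nat.le_ceil _
  have hJle : (J : ℝ) ≤ 18700 * sD + 1 := (Nat.ceil_lt_add_one (by positivity)).le
  set ρ : ℕ → ℝ := fun k => 2 * R + (k : ℝ) * (R + 4) with hρ
  have hρ0 : ∀ k, 0 ≤ ρ k := fun k => by simp only [hρ]; positivity
  have hρsucc : ∀ k, ρ (k + 1) = ρ k + (R + 4) := fun k => by
    simp only [hρ, Nat.cast_add, Nat.cast_one]; ring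
  have hρmono : ∀ k k' : ℕ, k ≤ k' → ρ k ≤ ρ k' := fun k k' hk => by
    simp only [hρ]
    have h1 : (k : ℝ) ≤ k' := Nat.cast_le.mpr hk
    have h2 := mul_le_mul_of_nonneg_right h1 (show 0 ≤ R + 4 by linarith)
    linarith
  have hρzero : ρ 0 = 2 * R := by simp only [hρ, Nat.cast_zero, zero_mul, add_zero]
  have hband : ρ J + 4 ≤ Real.exp (2 * Real.pi * D) / 4 := by
    have h1 : 238095 / 10000 ≤ 2 * Real.pi * D := by linarith
    have h2 := exp_band h1
    have h3 : ρ J + 4 ≤ 11225 * 10 ^ 5 * D := by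
      simp only [hρ, hR]
      have hJ' := mul_le_mul_of_nonneg_right hJle (show (0 : ℝ) ≤ 60000 * sD + 4 by positivity)
      linarith [hsD2, hsD1, hsDD, hJ', hD]
    linarith
  -- local sups
  have hu0 : ∀ k, 0 ≤ supOn (oddPart f) (ρ k) := fun k => supOn_nonneg _ hgc (hρ0 k)
  have huM : ∀ k, supOn (oddPart f) (ρ k) ≤ M := fun k => supOn_le _ hgc (hρ0 k) hmax
  have humono : ∀ k k' : ℕ, k ≤ k' → supOn (oddPart f) (ρ k) ≤ supOn (oddPart f) (ρ k') :=
    fun k k' hk => supOn_mono _ hgc (hρ0 k) (hρmono k k' hk)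
  have hule : ∀ k (y : ℝ), |y| ≤ ρ k → ‖tfT (oddPart f) y 0‖ ≤ supOn (oddPart f) (ρ k) :=
    fun k y hy => le_supOn _ hgc hy
  -- the local pairing bound
  set P : ℝ := supOn (oddPart f) (ρ 0) + 2 * τ * (M - supOn (oddPart f) (ρ 0)) with hP
  have hP0 : 0 ≤ P := by
    have h1 := mul_nonneg hτ0 (sub_nonneg.mpr (huM 0))
    have h2 := hu0 0
    rw [hP]; linarith
  have hpair : ‖∫ u in Icc (-1 : ℝ) 1, 2 * (Real.sinh (κ₀ * u) : ℂ) * f u‖ ≤ 2 * P * Real.sinh κ₀ := by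
    rw [pairing_oddPart hfc]
    have h := norm_pairing_le_local (oddPart f) hgc hmax hRπ
      (fun w hw => hule 0 w (by rw [hρzero]; exact hw)) (huM 0) hκ₀.le (by linarith)
    rw [← hτ, ← hP] at h
    exact h
  have hsinh := SignConeRung.sinh_le_of_le_half hκ₀.le hκ₀'.le
  have hΦ := SignConeRung.Phi_lower hκ₀
  have hΦ0 : 0 ≤ Phi κ₀ := le_trans (by positivity) hΦ
  have hθ' : 2 * Real.pi * θ ≤ 2 * Real.pi * (21 / 500) := mul_le_mul_of_nonneg_left hθ (by positivity)
  have hRD : 0 ≤ (∫ u in Icc (-1 : ℝ) 1, ‖f u‖ ^ 2) / D := div_nonneg hEf0 hD0.le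
  rcases le_or_gt (P ^ 2 * D) (23104 / 10000 * ∫ u in Icc (-1 : ℝ) 1, ‖f u‖ ^ 2) with hA | hB
  · ------------------------------------------------------------------ Branch A: low energy ⇒ empty certificate
    refine ⟨0, Fin.elim0, Fin.elim0, Fin.elim0, fun i => i.elim0, fun lam κ _ _ => by simp, ?_⟩
    simp only [Finset.univ_eq_empty, Finset.sum_empty, add_zero]
    set X := ‖∫ u in Icc (-1 : ℝ) 1, 2 * (Real.sinh (κ₀ * u) : ℂ) * f u‖ with hX_def
    have hX0 : 0 ≤ X := norm_nonneg _
    have hX : X ≤ 2.0844 * κ₀ * P := by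
      have h1 : 2 * P * Real.sinh κ₀ ≤ 2 * P * (2 * κ₀ * 0.5211) :=
        mul_le_mul_of_nonneg_left hsinh (by linarith)
      calc X ≤ 2 * P * Real.sinh κ₀ := hpair
        _ ≤ 2 * P * (2 * κ₀ * 0.5211) := h1
        _ = 2.0844 * κ₀ * P := by ring
    have hX2 : X ^ 2 ≤ (2.0844 * κ₀ * P) ^ 2 := pow_le_pow_left₀ hX0 hX 2
    have hkey : 2 * 3.141593 * (21 / 500) * (2.0844 * κ₀ * P) ^ 2 ≤
        1 * (8 / 3 * κ₀ ^ 2) * ((∫ u in Icc (-1 : ℝ) 1, ‖f u‖ ^ 2) / D) := by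
      rw [show 1 * (8 / 3 * κ₀ ^ 2) * ((∫ u in Icc (-1 : ℝ) 1, ‖f u‖ ^ 2) / D)
          = (8 / 3 * κ₀ ^ 2 * ∫ u in Icc (-1 : ℝ) 1, ‖f u‖ ^ 2) / D by ring, le_div_iff₀ hD0]
      have h := mul_le_mul_of_nonneg_left hA (sq_nonneg κ₀)
      have h' := mul_nonneg (sq_nonneg κ₀) hEf0
      linarith [h, h']
    calc 2 * Real.pi * θ * X ^ 2 ≤ 2 * Real.pi * (21 / 500) * X ^ 2 :=
          mul_le_mul_of_nonneg_right hθ' (sq_nonneg X)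
      _ ≤ 2 * 3.141593 * (21 / 500) * (2.0844 * κ₀ * P) ^ 2 := by gcongr
      _ ≤ 1 * (8 / 3 * κ₀ ^ 2) * ((∫ u in Icc (-1 : ℝ) 1, ‖f u‖ ^ 2) / D) := hkey
      _ ≤ (1 + ε) * Phi κ₀ * ((∫ u in Icc (-1 : ℝ) 1, ‖f u‖ ^ 2) / D) := by gcongr; linarith
  · ------------------------------------------------------------------ Branch B: the localised two-lobe certificate
    -- `M ≤ 0.93046 √D · u₀`
    have hMP : M ^ 2 < 8657 / 10000 * D * P ^ 2 := by rw [hM2]; linarith [hB, hEgf]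
    have hMP' : M ≤ 93044 / 100000 * sD * P := by
      have e : (93044 / 100000 * sD * P) ^ 2 = (93044 / 100000) ^ 2 * D * P ^ 2 := by rw [← hsD2]; ring
      have hDP : 0 ≤ D * P ^ 2 := by positivity
      have h1 : M ^ 2 ≤ (93044 / 100000 * sD * P) ^ 2 := by rw [e]; linarith [hMP]
      have h2 := abs_le_of_sq_le_sq h1 (by positivity)
      rwa [abs_of_nonneg hM0] at h2
    have hPu : P ≤ 100002 / 100000 * supOn (oddPart f) (ρ 0) := by
      have h1 : P ≤ supOn (oddPart f) (ρ 0) + 2 * τ * M := by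
        have := mul_nonneg hτ0 (hu0 0); rw [hP]; linarith
      have h2 : 2 * τ * M ≤ 2 * τ * (93044 / 100000 * sD * P) := mul_le_mul_of_nonneg_left hMP' (by positivity)
      have h3 : 2 * τ * (93044 / 100000 * sD * P) ≤ 197552 / 10 ^ 10 * P := by
        have := mul_le_mul_of_nonneg_right hτb (show 0 ≤ 2 * (93044 / 100000) * P by positivity)
        linarith [this]
      linarith [h1, h2, h3, hu0 0, hP0]
    have hPpos : 0 < P := by
      have hP2 : 0 < P ^ 2 * D := lt_of_le_of_lt (by positivity) hB
      rcases eq_or_lt_of_le hP0 with h | h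
      · rw [← h] at hP2; simp at hP2
      · exact h
    have hu0pos : 0 < supOn (oddPart f) (ρ 0) := by linarith [hPu, hPpos]
    have hMu : M ≤ 93046 / 100000 * sD * supOn (oddPart f) (ρ 0) := by
      have h1 := mul_le_mul_of_nonneg_left hPu (show 0 ≤ 93044 / 100000 * sD by positivity)
      have hsu : 0 ≤ sD * supOn (oddPart f) (ρ 0) := mul_nonneg hsD0.le (hu0 0)
      linarith [hMP', h1, hsu]
    -- radius pigeonhole
    obtain ⟨k, hkJ, hk⟩ := exists_ratio_step (J := J) (η := 5 / 100000) (by norm_num)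
      (fun k => supOn (oddPart f) (ρ k)) hu0 (by
        have h1 := huM J
        have h2 : 93046 / 100000 * sD < 1 + (J : ℝ) * (5 / 100000) := by linarith [hJge, hsD0]
        have h3 := mul_lt_mul_of_pos_right h2 hu0pos
        linarith)
    obtain ⟨c, hcρ, hcm⟩ := exists_eq_supOn (oddPart f) hgc (hρ0 k)
    set m := supOn (oddPart f) (ρ k) with hm_def
    set Mloc := supOn (oddPart f) (ρ (k + 1)) with hMloc_def
    have hu0m : supOn (oddPart f) (ρ 0) ≤ m := humono 0 k (Nat.zero_le k)
    have hm0 : 0 < m := lt_of_lt_of_le hu0pos hu0m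
    have hmMloc : m ≤ Mloc := humono k (k + 1) (Nat.le_succ k)
    have hMlocM : Mloc ≤ M := huM (k + 1)
    have hMloc0 : 0 ≤ Mloc := hm0.le.trans hmMloc
    set Mx : ℝ := Mloc + 4 * τ * (M - Mloc) with hMx
    have hτMM : 0 ≤ τ * (M - Mloc) := mul_nonneg hτ0 (sub_nonneg.mpr hMlocM)
    have hMlocMx : Mloc ≤ Mx := by rw [hMx]; linarith
    have hmMx : m ≤ Mx := hmMloc.trans hMlocMx
    have hMx0 : 0 < Mx := lt_of_lt_of_le hm0 hmMx
    have hMxm : Mx ≤ 10000896 / 10000000 * m := by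
      have h1 : Mx ≤ (1 + 5 / 100000) * m + 4 * (τ * M) := by
        have := mul_nonneg hτ0 hMloc0; rw [hMx]; linarith [hk]
      have h2 : τ * M ≤ τ * (93046 / 100000 * sD * supOn (oddPart f) (ρ 0)) := mul_le_mul_of_nonneg_left hMu hτ0
      have h3 : τ * (93046 / 100000 * sD * supOn (oddPart f) (ρ 0)) ≤ 98778 / 10 ^ 10 * m := by
        have := mul_le_mul_of_nonneg_right hτb
          (show 0 ≤ 93046 / 100000 * supOn (oddPart f) (ρ 0) by positivity)
        linarith [this, hu0m, hu0 0]
      linarith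
    -- the defect angle
    have hq1 : m / Mx ≤ 1 := (div_le_one hMx0).mpr hmMx
    have hq : 1 - 9 / 100000 ≤ m / Mx := by
      rw [le_div_iff₀ hMx0]; linarith [hMxm, hm0.le]
    have hA_le : Real.arccos (m / Mx) ≤ 142 / 10000 := arccos_le_of_ge hq1 hq
    have hA_nn : 0 ≤ Real.arccos (m / Mx) := Real.arccos_nonneg _
    set A := Real.arccos (m / Mx) with hA_def
    -- local hypotheses at a centre `c'` with `|c'| ≤ ρ k`
    have hloc_of : ∀ c' : ℝ, |c'| ≤ ρ k → ∀ y : ℝ, |y - c'| ≤ π → ∀ z : ℝ, |z - y| ≤ R →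
        ‖tfT (oddPart f) z 0‖ ≤ Mloc := by
      intro c' hc' y hy z hz
      apply hule (k + 1)
      rw [hρsucc]
      have h1 : |z| ≤ |z - y| + |y - c'| + |c'| := by
        have e : z = (z - y) + (y - c') + c' := by ring
        calc |z| = |(z - y) + (y - c') + c'| := by rw [← e]
          _ ≤ |(z - y) + (y - c')| + |c'| := abs_add_le _ _
          _ ≤ |z - y| + |y - c'| + |c'| := by linarith [abs_add_le (z - y) (y - c')]
      linarith
    have hDSloc_of : ∀ c' : ℝ, |c'| ≤ ρ k → ∀ y : ℝ, |y - c'| ≤ π → ∀ w : ℂ, ‖w‖ ≤ 1 →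
        (w * tfT (oddPart f) y 0).re ^ 2 + (w * tfT₁ (oddPart f) y).re ^ 2 ≤ Mx ^ 2 := by
      intro c' hc' y hy w hw
      have h := re_sq_add_re_sq_le_local' (oddPart f) hgc hmax y hRπ (hloc_of c' hc' y hy) hMlocM w hw
      rw [← hτ] at h
      have h1 : Mloc + τ * (M - Mloc) ≤ Mx := by rw [hMx]; linarith [hτMM]
      have h2 : 0 ≤ Mloc + τ * (M - Mloc) := by linarith [hτMM, hMloc0]
      exact h.trans (pow_le_pow_left₀ h2 h1 2)
    have hdent_of : ∀ c' : ℝ, |c'| ≤ ρ k → ∀ x : ℝ, |x - c'| ≤ π → ∀ κ : ℝ, 0 < κ → κ ≤ 1 / 2 →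
        ‖tfT (oddPart f) x κ - (Real.sinh κ / κ : ℝ) * tfT (oddPart f) x 0‖
          ≤ (Real.cosh κ - Real.sinh κ / κ) * Mx := by
      intro c' hc' x hx κ hκp hκh
      have h := CoshKernel.norm_tfT_sub_le_local (oddPart f) hgc κ hκp hmax x hRπ (hloc_of c' hc' x hx) hMlocM
      rw [← hτ] at h
      have h4 := kappa_sinh_le_four_dent hκp (by linarith)
      have hMM : 0 ≤ τ * (M - Mloc) := mul_nonneg hτ0 (by linarith)
      have h5 := mul_le_mul_of_nonneg_right h4 hMM
      have e : (Real.cosh κ - Real.sinh κ / κ) * Mx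
          = (Real.cosh κ - Real.sinh κ / κ) * Mloc + 4 * (Real.cosh κ - Real.sinh κ / κ) * (τ * (M - Mloc)) := by
        rw [hMx]; ring
      have e2 : (Real.cosh κ - Real.sinh κ / κ) * Mloc + κ * Real.sinh κ * τ * (M - Mloc)
          = (Real.cosh κ - Real.sinh κ / κ) * Mloc + κ * Real.sinh κ * (τ * (M - Mloc)) := by ring
      rw [e]; rw [e2] at h
      linarith
    -- the two centres `c`, `−c`
    have hcm' : ‖tfT (oddPart f) (-c) 0‖ = m := by rw [norm_tfT_oddPart_neg hreal]; exact hcm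
    have hcρ' : |(-c)| ≤ ρ k := by rw [abs_neg]; exact hcρ
    have hfar : π / 2 - A ≤ |c| :=
      nearmax_far_local (oddPart f) hgc hm0 hMx0 (hDSloc_of c hcρ) hcm (tfT_oddPart_zero f) (by linarith)
    have hfar' : π / 2 - A ≤ |(-c)| := by rwa [abs_neg]
    have hgeo : ∀ j : ℕ, j < 16 → ∀ c' : ℝ, π / 2 - A ≤ |c'| →
        ¬ (c' - (π / 2 - yN j - A) < 0 ∧ 0 ≤ c' + (π / 2 - yN j - A)) := by
      intro j hj c' hc' ⟨h1, h2⟩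
      obtain ⟨hy1, hy2⟩ := yN_mem j hj
      have : |c'| ≤ π / 2 - yN j - A := abs_le.mpr ⟨by linarith, by linarith⟩
      linarith
    have hρkJ : ρ k ≤ ρ J := hρmono k J hkJ.le
    refine ⟨16 + 16, aWd c A, bWd c A, tW Mx, ?_, ?_, ?_⟩
    · ---------------------------------------------------------------- admissibility
      intro i
      have habs := abs_le.mp hcρ
      induction i using Fin.addCases with
      | left j =>
          simp only [aWd, bWd, tW, Fin.append_left]
          obtain ⟨hy1, hy2⟩ := yN_mem j j.isLt
          have ht : 0 ≤ Mx ^ 2 * (sN (j : ℕ) ^ 2 - sN ((j : ℕ) + 1) ^ 2) := by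
            have h1 := sN_succ_le (j : ℕ)
            have h2 := sN_nonneg ((j : ℕ) + 1)
            have : sN ((j : ℕ) + 1) ^ 2 ≤ sN (j : ℕ) ^ 2 := pow_le_pow_left₀ h2 h1 2
            exact mul_nonneg (sq_nonneg Mx) (by linarith)
          exact ⟨by linarith, by linarith, by linarith, by linarith, ht⟩
      | right j =>
          simp only [aWd, bWd, tW, Fin.append_right]
          obtain ⟨hy1, hy2⟩ := yN_mem j j.isLt
          have ht : 0 ≤ Mx ^ 2 * (sN (j : ℕ) ^ 2 - sN ((j : ℕ) + 1) ^ 2) := by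
            have h1 := sN_succ_le (j : ℕ)
            have h2 := sN_nonneg ((j : ℕ) + 1)
            have : sN ((j : ℕ) + 1) ^ 2 ≤ sN (j : ℕ) ^ 2 := pow_le_pow_left₀ h2 h1 2
            exact mul_nonneg (sq_nonneg Mx) (by linarith)
          exact ⟨by linarith, by linarith, by linarith, by linarith, ht⟩
    · ---------------------------------------------------------------- the certificate is below ‖T f‖²
      intro lam κ hκ hκ'
      have hdom : ‖tfT (oddPart f) lam κ‖ ^ 2 ≤ ‖tfT f lam κ‖ ^ 2 :=
        pow_le_pow_left₀ (norm_nonneg _) (norm_tfT_oddPart_le hreal hfc lam κ) 2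
      have hAc := lobe_levels_local (oddPart f) hgc hm0 hMx0 (hDSloc_of c hcρ) (hdent_of c hcρ) hcm
        (lam := lam) hκ hκ'.le
      have hBc := lobe_levels_local (oddPart f) hgc hm0 hMx0 (hDSloc_of (-c) hcρ') (hdent_of (-c) hcρ') hcm'
        (lam := lam) hκ hκ'.le
      rw [Finset.sum_filter, Fin.sum_univ_add]
      simp only [aWd, bWd, tW, Fin.append_left, Fin.append_right]
      rw [Fin.sum_univ_eq_sum_range (fun j => if c - (π / 2 - yN j - A) < lam ∧ lam ≤ c + (π / 2 - yN j - A)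
            then Mx ^ 2 * (sN j ^ 2 - sN (j + 1) ^ 2) else 0) 16,
          Fin.sum_univ_eq_sum_range (fun j => if -c - (π / 2 - yN j - A) < lam ∧ lam ≤ -c + (π / 2 - yN j - A)
            then Mx ^ 2 * (sN j ^ 2 - sN (j + 1) ^ 2) else 0) 16]
      rw [Finset.sum_filter] at hAc hBc
      by_cases hact : ∃ j, j < 16 ∧ (c - (π / 2 - yN j - A) < lam ∧ lam ≤ c + (π / 2 - yN j - A))
      · obtain ⟨j₁, hj₁, hc1, hc2⟩ := hact
        obtain ⟨hy1, hy2⟩ := yN_mem j₁ hj₁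
        have hBz : (∑ j ∈ Finset.range 16, if -c - (π / 2 - yN j - A) < lam ∧ lam ≤ -c + (π / 2 - yN j - A)
            then Mx ^ 2 * (sN j ^ 2 - sN (j + 1) ^ 2) else 0) = 0 := by
          apply Finset.sum_eq_zero
          intro j hj
          rw [if_neg]
          rintro ⟨h1, h2⟩
          obtain ⟨hy1', hy2'⟩ := yN_mem j (Finset.mem_range.mp hj)
          have : |c| ≤ π / 2 - 221 / 1000 - A := abs_le.mpr ⟨by linarith, by linarith⟩
          linarith
        rw [hBz, add_zero]
        exact hAc.trans hdom
      · have hAz : (∑ j ∈ Finset.range 16, if c - (π / 2 - yN j - A) < lam ∧ lam ≤ c + (π / 2 - yN j - A)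
            then Mx ^ 2 * (sN j ^ 2 - sN (j + 1) ^ 2) else 0) = 0 := by
          apply Finset.sum_eq_zero
          intro j hj
          rw [if_neg]
          intro hcond
          exact hact ⟨j, Finset.mem_range.mp hj, hcond⟩
        rw [hAz, zero_add]
        exact hBc.trans hdom
    · ---------------------------------------------------------------- credit versus pairing
      rw [Fin.sum_univ_add]
      simp only [aWd, bWd, tW, Fin.append_left, Fin.append_right]
      rw [Fin.sum_univ_eq_sum_range (fun j => Mx ^ 2 * (sN j ^ 2 - sN (j + 1) ^ 2) *
            (c + (π / 2 - yN j - A) - (c - (π / 2 - yN j - A)) - 3 / 2 -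
              if c - (π / 2 - yN j - A) < 0 ∧ 0 ≤ c + (π / 2 - yN j - A) then 3 / 2 else 0)) 16,
          Fin.sum_univ_eq_sum_range (fun j => Mx ^ 2 * (sN j ^ 2 - sN (j + 1) ^ 2) *
            (-c + (π / 2 - yN j - A) - (-c - (π / 2 - yN j - A)) - 3 / 2 -
              if -c - (π / 2 - yN j - A) < 0 ∧ 0 ≤ -c + (π / 2 - yN j - A) then 3 / 2 else 0)) 16]
      have hcred : ∀ c' : ℝ, π / 2 - A ≤ |c'| →
          Mx ^ 2 * (571 / 2500 - 2 * A * sN 0 ^ 2) ≤ ∑ j ∈ Finset.range 16, Mx ^ 2 * (sN j ^ 2 - sN (j + 1) ^ 2) *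
            (c' + (π / 2 - yN j - A) - (c' - (π / 2 - yN j - A)) - 3 / 2 -
              if c' - (π / 2 - yN j - A) < 0 ∧ 0 ≤ c' + (π / 2 - yN j - A) then 3 / 2 else 0) := by
        intro c' hc'
        have h := credit16_defect A hA_nn
        calc Mx ^ 2 * (571 / 2500 - 2 * A * sN 0 ^ 2)
            ≤ Mx ^ 2 * ∑ j ∈ Finset.range 16,
                (sN j ^ 2 - sN (j + 1) ^ 2) * (1641592 / 1000000 - 2 * yN j - 2 * A) :=
              mul_le_mul_of_nonneg_left h (sq_nonneg Mx)
          _ = ∑ j ∈ Finset.range 16,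
                Mx ^ 2 * ((sN j ^ 2 - sN (j + 1) ^ 2) * (1641592 / 1000000 - 2 * yN j - 2 * A)) := by
              rw [Finset.mul_sum]
          _ ≤ _ := by
              apply Finset.sum_le_sum
              intro j hj
              have hj16 := Finset.mem_range.mp hj
              rw [if_neg (hgeo j hj16 c' hc')]
              have ht : 0 ≤ sN j ^ 2 - sN (j + 1) ^ 2 := by
                have h1 := sN_succ_le j
                have h2 := sN_nonneg (j + 1)
                have : sN (j + 1) ^ 2 ≤ sN j ^ 2 := pow_le_pow_left₀ h2 h1 2
                linarith
              have hM2 : 0 ≤ Mx ^ 2 := sq_nonneg Mx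
              have hlen : 1641592 / 1000000 - 2 * yN j - 2 * A ≤
                  c' + (π / 2 - yN j - A) - (c' - (π / 2 - yN j - A)) - 3 / 2 - 0 := by linarith
              calc Mx ^ 2 * ((sN j ^ 2 - sN (j + 1) ^ 2) * (1641592 / 1000000 - 2 * yN j - 2 * A))
                  = (Mx ^ 2 * (sN j ^ 2 - sN (j + 1) ^ 2)) * (1641592 / 1000000 - 2 * yN j - 2 * A) := by ring
                _ ≤ (Mx ^ 2 * (sN j ^ 2 - sN (j + 1) ^ 2)) *
                    (c' + (π / 2 - yN j - A) - (c' - (π / 2 - yN j - A)) - 3 / 2 - 0) :=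
                    mul_le_mul_of_nonneg_left hlen (mul_nonneg hM2 ht)
      have hcredA := hcred c hfar
      have hcredB := hcred (-c) hfar'
      set CR := (∑ j ∈ Finset.range 16, Mx ^ 2 * (sN j ^ 2 - sN (j + 1) ^ 2) *
            (c + (π / 2 - yN j - A) - (c - (π / 2 - yN j - A)) - 3 / 2 -
              if c - (π / 2 - yN j - A) < 0 ∧ 0 ≤ c + (π / 2 - yN j - A) then 3 / 2 else 0)) +
          ∑ j ∈ Finset.range 16, Mx ^ 2 * (sN j ^ 2 - sN (j + 1) ^ 2) *
            (-c + (π / 2 - yN j - A) - (-c - (π / 2 - yN j - A)) - 3 / 2 -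
              if -c - (π / 2 - yN j - A) < 0 ∧ 0 ≤ -c + (π / 2 - yN j - A) then 3 / 2 else 0) with hCR
      have hs0 := sN_zero_sq_le
      have hdef : 216375 / 1000000 ≤ 571 / 2500 - 2 * A * sN 0 ^ 2 := by
        have h1 : A * sN 0 ^ 2 ≤ 142 / 10000 * (4234 / 10000) := by
          have := mul_le_mul hA_le hs0 (sq_nonneg _) (by norm_num)
          linarith
        linarith
      have hCR2 : 2 * (Mx ^ 2 * (216375 / 1000000)) ≤ CR := by
        have h2 := mul_le_mul_of_nonneg_left hdef (sq_nonneg Mx)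
        rw [hCR]; linarith [hcredA, hcredB, h2]
      have hCR0 : 0 ≤ CR := le_trans (by positivity) hCR2
      set X := ‖∫ u in Icc (-1 : ℝ) 1, 2 * (Real.sinh (κ₀ * u) : ℂ) * f u‖ with hX_def
      have hX0 : 0 ≤ X := norm_nonneg _
      have hPMx : P ≤ 100002 / 100000 * Mx := by linarith [hPu, hu0m, hmMx]
      have hX : X ≤ 2.0844 * κ₀ * (100002 / 100000 * Mx) := by
        have h1 : 2 * P * Real.sinh κ₀ ≤ 2 * (100002 / 100000 * Mx) * Real.sinh κ₀ := by
          apply mul_le_mul_of_nonneg_right _ (Real.sinh_nonneg_iff.mpr hκ₀.le); linarith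
        have h2 : 2 * (100002 / 100000 * Mx) * Real.sinh κ₀ ≤ 2 * (100002 / 100000 * Mx) * (2 * κ₀ * 0.5211) :=
          mul_le_mul_of_nonneg_left hsinh (by linarith [hMx0])
        calc X ≤ 2 * P * Real.sinh κ₀ := hpair
          _ ≤ 2 * (100002 / 100000 * Mx) * (2 * κ₀ * 0.5211) := h1.trans h2
          _ = 2.0844 * κ₀ * (100002 / 100000 * Mx) := by ring
      have hX2 : X ^ 2 ≤ (2.0844 * κ₀ * (100002 / 100000 * Mx)) ^ 2 := pow_le_pow_left₀ hX0 hX 2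
      have hkk : 0 ≤ κ₀ ^ 2 * Mx ^ 2 := by positivity
      calc 2 * Real.pi * θ * X ^ 2 ≤ 2 * Real.pi * (21 / 500) * X ^ 2 :=
            mul_le_mul_of_nonneg_right hθ' (sq_nonneg X)
        _ ≤ 2 * 3.141593 * (21 / 500) * (2.0844 * κ₀ * (100002 / 100000 * Mx)) ^ 2 := by gcongr
        _ ≤ 1 * (8 / 3 * κ₀ ^ 2) * (2 * (Mx ^ 2 * (216375 / 1000000))) := by linarith [hkk]
        _ ≤ (1 + ε) * Phi κ₀ * CR := by gcongr; linarith
        _ ≤ (1 + ε) * Phi κ₀ * ((∫ u in Icc (-1 : ℝ) 1, ‖f u‖ ^ 2) / D + CR) := by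
            have h0 : 0 ≤ (1 + ε) * Phi κ₀ := mul_nonneg (by linarith) hΦ0
            have h1 := mul_nonneg h0 hRD
            linarith [h1]

end Summit.RiemannHypothesis.RiemannHypothesis.Theorems.Splittings.XWucG8.DSLine
namespace Summit.RiemannHypothesis.RiemannHypothesis.Theorems.Splittings.XWucG8
end Summit.RiemannHypothesis.RiemannHypothesis.Theorems.Splittings.XWucG8
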